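import Summits.QuantumFields.YangMills.Theorems.ColdStartUniversalityShenZhuZhuTalagrandSU2
import Summits.QuantumFields.YangMills.Theorems.ColdStartUniversalityWilsonGibbsLipschitzConcentration
import Summits.QuantumFields.YangMills.Theorems.ColdStartUniversalityShenZhuZhuW2GeometricErgodicitySU2
import Summits.QuantumFields.YangMills.Theorems.ColdStartUniversalityUniformColdStartMixingFixedCutoffMixingTimeWindow
import HarnessLib

/-!
# ENTROPIC `W₂` MIXING of the `SU(2)` lattice Langevin dynamics on `(ℤ/L)³`, `|β'| < 1/12`, uniformly in the volume —
# `W₂^{ρ_L}(νP_t, μ_(β'))² ≤ e^{−2(1−12|β'|)t}·(2/(1−12|β'|))·KL(ν‖μ_(β'))` for EVERY initial law `ν` of finite relative entropy —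
# and the `T₂` / concentration / entropic-mixing package AT THE ROUTE'S CUT-OFFS inside the window `γε_K > 6`

Seat `ym-line-csu-p1` (g42), route `ColdStartUniversality` of `Summits/QuantumFields/YangMills`, planner-facing helper file G72
(`--supports stmt-QuantumFields-24809`).  G66 (`W₂` contraction for all initial laws, `wilson_szzWasserstein_W2_convergence_of_initialLaw`) × G70b
(Talagrand `T₂`, `wilson_talagrand_T2`) give the entropic mixing bound; the window statements specialise G70b/G71 and it to the route's `K`-th cut-off
(`L_K = (F.P K).sitesPerDir 0`, `β'_K = (γε_K)⁻¹/2`, `1 − 12|β'_K| = 1 − 6/(γε_K)` by `window_coupling_bounds`).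

* ★★★★ **`wilson_szzWasserstein_W2_convergence_of_klDiv`** — for every realising kernel family `κ`, every initial law `ν` with `KL(ν‖μ_(β')) < ∞` and
  `t > 0`:  `szzWassersteinSq ρ_L² (κ_t∘ν) μ_(β') ≤ ofReal(e^{−2(1−12|β'|)t}·(2/(1−12|β'|))·KL(ν‖μ_(β')))`;
* ★★ `talagrand_T2_fixedCutoff_window` — `T₂(1/(1 − 6/(γε_K)))` for the `K`-th Wilson–Gibbs law, `6 < γε_K`;
* ★★ `lipschitz_concentration_fixedCutoff_window` — `μ_K{r ≤ F − ∫F dμ_K} ≤ exp(−r²(1 − 6/(γε_K))/(2L_F²))`;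
* ★★ `W2_convergence_of_klDiv_fixedCutoff_window` — the entropic mixing bound for the `K`-th dynamics, rate `1 − 6/(γε_K)` per unit lattice time.

THEOREMS ONLY, no definition, no sorry.  PLANNER-FACING, HONEST: the volume-uniform statements hold at fixed `β'`, `|β'| < 1/12`; the window
statements need `6 < γε_K`, which FAILS as `ε_K → 0` at fixed `γ` — NOT uniform in `K` in the sense of `UniformColdStartMixing` (stmt-24809, ASIDE,
NOT restated or weakened); no crux, rung or summit statement is proved; the Yang–Mills mass gap is NOT proved.
-/

set_option autoImplicit false

noncomputable section

namespace Summit.QuantumFields.YangMills.Theorems.ColdStartUniversality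

open MeasureTheory ProbabilityTheory Matrix Complex Finset Filter Topology Set InformationTheory
open scoped ComplexConjugate BigOperators NNReal ENNReal
open Literature.Probability.Process Literature.MathematicalPhysics.QuantumFieldTheory
open Literature.MathematicalPhysics.QuantumFieldTheory.Balaban1983to89
open Literature.MathematicalPhysics.QuantumLattice (fundamentalRep fundamentalLatticeRep continuous_fundamentalRep fundamentalRep_apply fundamentalLatticeRep_N)

/-! ## §1. Entropic `W₂` mixing, uniformly in the volume -/

/-- ★★★★ **Entropic `W₂` mixing, volume-uniform.**  For `|β'| < 1/12`, every `L`, every realising kernel family `κ` of the `SU(2)` lattice Langevin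
dynamics, every initial law `ν` with `KL(ν‖μ_(β')) < ∞` and every `t > 0`:
`szzWassersteinSq ρ_L² (κ_t ∘ₘ ν) μ_(β') ≤ ofReal(exp(−2(1−12|β'|)t)·(2·(1/(1−12|β'|)))·KL(ν‖μ_(β')))` — `W₂` convergence to equilibrium at the
volume-free rate with an ENTROPY (not diameter) prefactor (G66 × Talagrand `T₂`, G70b).  The Yang–Mills mass gap is NOT proved.
[cite: BakryGentilLedoux2014, Thm 9.6.1 and Thm 9.7.2] [cite: ShenZhuZhu2022, Theorem 4.2 (4.5), Corollary 4.4] -/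
theorem wilson_szzWasserstein_W2_convergence_of_klDiv (L : ℕ) [NeZero L]
    (ν : Measure (GaugeConfig 3 L (Matrix.specialUnitaryGroup (Fin 2) ℂ))) [IsProbabilityMeasure ν] (β' : ℝ) (hβ : |β'| < 1 / 12)
    (hfin : klDiv ν (wilsonMeasure (d := 3) (L := L) (fundamentalRep (Fin 2)) β') ≠ ∞)
    (κ : ℝ≥0 → Kernel (GaugeConfig 3 L (Matrix.specialUnitaryGroup (Fin 2) ℂ))
      (GaugeConfig 3 L (Matrix.specialUnitaryGroup (Fin 2) ℂ))) [∀ t, IsMarkovKernel (κ t)]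
    (hreal : ∀ (t : ℝ≥0) (x : GaugeConfig 3 L (Matrix.specialUnitaryGroup (Fin 2) ℂ))
        (Ω : Type) [MeasurableSpace Ω] (P : Measure Ω) [IsProbabilityMeasure P]
        (W : ℝ≥0 → Ω → (Edge 3 L × NoiseIdx 2 → ℝ)) (hW : IsFlatBrownian W P)
        (U : ℝ≥0 → Ω → GaugeConfig 3 L (Matrix.specialUnitaryGroup (Fin 2) ℂ)),
        (∀ ω, U 0 ω = x) →
        (latticeLangevinDynamics (fundamentalLatticeRep 2) β').IsSolution (fundamentalRep (Fin 2))
          hW.natFiltration P W U →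
        κ t x = P.map (U t))
    {t : ℝ≥0} (ht : 0 < (t : ℝ)) :
    szzWassersteinSq (torusRiemannDistSq (fundamentalLatticeRep 2)) (κ t ∘ₘ ν) (wilsonMeasure (d := 3) (L := L) (fundamentalRep (Fin 2)) β') ≤
      ENNReal.ofReal (Real.exp (-(2 * (1 - 12 * |β'|) * (t : ℝ))) *
        (2 * (1 / (1 - 12 * |β'|)) * (klDiv ν (wilsonMeasure (d := 3) (L := L) (fundamentalRep (Fin 2)) β')).toReal)) := by
  have h1 := wilson_szzWasserstein_W2_convergence_of_initialLaw L ν β' hβ κ hreal ht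
  have h2 := wilson_talagrand_T2 L β' hβ ν hfin
  rw [ENNReal.ofReal_mul (Real.exp_pos _).le]
  exact h1.trans (mul_le_mul' le_rfl h2)

/-! ## §2. At the route's cut-offs, inside the window `γε_K > 6` -/

/-- ★★ **Talagrand's `T₂` at the route's cut-offs, window `γε_K > 6`.**  For every cut-off `K` with `6 < γε_K` and every probability `ν` on the `K`-th
configuration space with `KL(ν‖μ_K) < ∞` (`μ_K` = the Wilson–Gibbs law at `β'_K = (γε_K)⁻¹/2` on `(ℤ/L_K)³`):
`szzWassersteinSq ρ_L² ν μ_K ≤ ofReal(2·(1/(1 − 6/(γε_K)))·KL(ν‖μ_K))`.  The Yang–Mills mass gap is NOT proved. [cite: BakryGentilLedoux2014, Thm 9.6.1] -/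
theorem talagrand_T2_fixedCutoff_window (F : T3ContinuumYM3Torus.T3Family) (γ : ℝ) (K : ℕ) (hK : 6 < γ * (F.P K).eps)
    (ν : Measure (GaugeConfig 3 ((F.P K).sitesPerDir 0) (Matrix.specialUnitaryGroup (Fin 2) ℂ))) [IsProbabilityMeasure ν]
    (hfin : klDiv ν (wilsonMeasure (d := 3) (L := (F.P K).sitesPerDir 0) (fundamentalRep (Fin 2)) ((γ * (F.P K).eps)⁻¹ / 2)) ≠ ∞) :
    szzWassersteinSq (torusRiemannDistSq (fundamentalLatticeRep 2)) ν
        (wilsonMeasure (d := 3) (L := (F.P K).sitesPerDir 0) (fundamentalRep (Fin 2)) ((γ * (F.P K).eps)⁻¹ / 2)) ≤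
      ENNReal.ofReal (2 * (1 / (1 - 6 / (γ * (F.P K).eps))) *
        (klDiv ν (wilsonMeasure (d := 3) (L := (F.P K).sitesPerDir 0) (fundamentalRep (Fin 2)) ((γ * (F.P K).eps)⁻¹ / 2))).toReal) := by
  obtain ⟨hβ, hrate⟩ := window_coupling_bounds F γ K hK
  have h := wilson_talagrand_T2 ((F.P K).sitesPerDir 0) ((γ * (F.P K).eps)⁻¹ / 2) hβ ν hfin
  rw [hrate] at h
  exact h

/-- ★★ **Gaussian concentration of Lipschitz observables at the route's cut-offs, window `γε_K > 6`.**  For every cut-off `K` with `6 < γε_K`, every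
`ρ_L`-Lipschitz `G : SU(2)^{E_K} → ℝ` with constant `L_G ≥ 0` and every `r ≥ 0`:
`μ_K{x | r ≤ G(x) − ∫G dμ_K} ≤ exp(−r²(1 − 6/(γε_K))/(2L_G²))`.  The Yang–Mills mass gap is NOT proved. [cite: BakryGentilLedoux2014, Prop 5.4.1] -/
theorem lipschitz_concentration_fixedCutoff_window (F : T3ContinuumYM3Torus.T3Family) (γ : ℝ) (K : ℕ) (hK : 6 < γ * (F.P K).eps)
    {G : GaugeConfig 3 ((F.P K).sitesPerDir 0) (Matrix.specialUnitaryGroup (Fin 2) ℂ) → ℝ} {LG : ℝ} (hLG : 0 ≤ LG)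
    (hlip : ∀ Q Q', |G Q' - G Q| ≤ LG * Real.sqrt (torusRiemannDistSq (fundamentalLatticeRep 2) Q Q')) {r : ℝ} (hr : 0 ≤ r) :
    (wilsonMeasure (d := 3) (L := (F.P K).sitesPerDir 0) (fundamentalRep (Fin 2)) ((γ * (F.P K).eps)⁻¹ / 2)).real
        {x | r ≤ G x - ∫ y, G y ∂(wilsonMeasure (d := 3) (L := (F.P K).sitesPerDir 0) (fundamentalRep (Fin 2)) ((γ * (F.P K).eps)⁻¹ / 2))} ≤
      Real.exp (-(r ^ 2 * (1 - 6 / (γ * (F.P K).eps)) / (2 * LG ^ 2))) := by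
  obtain ⟨hβ, hrate⟩ := window_coupling_bounds F γ K hK
  have h := wilson_lipschitz_concentration ((F.P K).sitesPerDir 0) ((γ * (F.P K).eps)⁻¹ / 2) hβ hLG hlip hr
  rw [hrate] at h
  exact h

/-- ★★ **Entropic `W₂` mixing at the route's cut-offs, window `γε_K > 6` (lattice time).**  For every cut-off `K` with `6 < γε_K`, every realising kernel
family `κ` of the `K`-th SZZ dynamics, every initial law `ν` with `KL(ν‖μ_K) < ∞` and every lattice time `t > 0`:
`szzWassersteinSq ρ_L² (κ_t∘ν) μ_K ≤ ofReal(exp(−2(1 − 6/(γε_K))t)·(2·(1/(1 − 6/(γε_K))))·KL(ν‖μ_K))`.  The Yang–Mills mass gap is NOT proved.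
[cite: ShenZhuZhu2022, Theorem 4.2 (4.5), Corollary 4.4] -/
theorem W2_convergence_of_klDiv_fixedCutoff_window (F : T3ContinuumYM3Torus.T3Family) (γ : ℝ) (K : ℕ) (hK : 6 < γ * (F.P K).eps)
    (ν : Measure (GaugeConfig 3 ((F.P K).sitesPerDir 0) (Matrix.specialUnitaryGroup (Fin 2) ℂ))) [IsProbabilityMeasure ν]
    (hfin : klDiv ν (wilsonMeasure (d := 3) (L := (F.P K).sitesPerDir 0) (fundamentalRep (Fin 2)) ((γ * (F.P K).eps)⁻¹ / 2)) ≠ ∞)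
    (κ : ℝ≥0 → Kernel (GaugeConfig 3 ((F.P K).sitesPerDir 0) (Matrix.specialUnitaryGroup (Fin 2) ℂ))
      (GaugeConfig 3 ((F.P K).sitesPerDir 0) (Matrix.specialUnitaryGroup (Fin 2) ℂ))) [∀ t, IsMarkovKernel (κ t)]
    (hreal : ∀ (t : ℝ≥0) (x : GaugeConfig 3 ((F.P K).sitesPerDir 0) (Matrix.specialUnitaryGroup (Fin 2) ℂ))
        (Ω : Type) [MeasurableSpace Ω] (P : Measure Ω) [IsProbabilityMeasure P]
        (W : ℝ≥0 → Ω → (Edge 3 ((F.P K).sitesPerDir 0) × NoiseIdx 2 → ℝ)) (hW : IsFlatBrownian W P)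
        (U : ℝ≥0 → Ω → GaugeConfig 3 ((F.P K).sitesPerDir 0) (Matrix.specialUnitaryGroup (Fin 2) ℂ)),
        (∀ ω, U 0 ω = x) →
        (latticeLangevinDynamics (fundamentalLatticeRep 2) ((γ * (F.P K).eps)⁻¹ / 2)).IsSolution (fundamentalRep (Fin 2))
          hW.natFiltration P W U →
        κ t x = P.map (U t))
    {t : ℝ≥0} (ht : 0 < (t : ℝ)) :
    szzWassersteinSq (torusRiemannDistSq (fundamentalLatticeRep 2)) (κ t ∘ₘ ν)
        (wilsonMeasure (d := 3) (L := (F.P K).sitesPerDir 0) (fundamentalRep (Fin 2)) ((γ * (F.P K).eps)⁻¹ / 2)) ≤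
      ENNReal.ofReal (Real.exp (-(2 * (1 - 6 / (γ * (F.P K).eps)) * (t : ℝ))) *
        (2 * (1 / (1 - 6 / (γ * (F.P K).eps))) *
          (klDiv ν (wilsonMeasure (d := 3) (L := (F.P K).sitesPerDir 0) (fundamentalRep (Fin 2)) ((γ * (F.P K).eps)⁻¹ / 2))).toReal)) := by
  obtain ⟨hβ, hrate⟩ := window_coupling_bounds F γ K hK
  have h := wilson_szzWasserstein_W2_convergence_of_klDiv ((F.P K).sitesPerDir 0) ν ((γ * (F.P K).eps)⁻¹ / 2) hβ hfin κ hreal ht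
  rw [hrate] at h
  exact h

end Summit.QuantumFields.YangMills.Theorems.ColdStartUniversality

end
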